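import Summits.KontsevichZagierPeriods.Zeta5Search.TwoTaleP15SecondTaleBSharp

/-!
# The two-tale point P15, second tale: valuation tools for the crude all-prime bound

HONEST FRAMING: systematic search; no irrationality claim unless certified.

Cell pub-zeta5, T3 service (denominator side only; nothing about irrationality).  Small prime-free tools used by
`TwoTaleP15SecondTaleCrude.lean` (‖p̂_n‖_p ≤ p^{3⌊log_p 33n⌋} at EVERY prime): `‖1/d‖_p ≤ p^{⌊log_p M⌋}` for
`0 < |d| ≤ M`; Kummer in the crude form `v_p(C(M,i)) ≤ ⌊log_p M⌋` (`Nat.factorization_choose_le_log`); the Legendre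
splitting `v_p((a+b)!) = v_p(C(a+b,a)) + v_p(a!) + v_p(b!)`; valuations of the blocks `(−1)^e·a!·b!`,
`(−1)^e·m!·C(K,m)` that the tree's evaluations of `numT`, `numT′`, `dhatT` at the poles produce; and crude bounds
for the alternating harmonic sums, `‖S₂(m)‖_p ≤ p^{2⌊log_p M⌋}`, `‖S₁(m)‖_p ≤ p^{⌊log_p M⌋}` (`m ≤ M`).
-/

noncomputable section

namespace Summit.KontsevichZagierPeriods.Zeta5Search.TwoTaleP15

open Finset Polynomial
open Literature.NumberTheory.Irrationality.Zudilin2014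

section Tools

variable {p : ℕ} [hp : Fact p.Prime]

/-- `‖1/d‖_p ≤ p^{⌊log_p M⌋}` for a nonzero integer `|d| ≤ M`. -/
theorem padicNorm_inv_int_le_log {d : ℤ} (hd : d ≠ 0) {M : ℕ} (hM : d.natAbs ≤ M) :
    padicNorm p (1 / (d : ℚ)) ≤ (p : ℚ) ^ (Nat.log p M) := by
  have hd' : (d : ℚ) ≠ 0 := by exact_mod_cast hd
  rw [one_div, padicNorm.eq_zpow_of_nonzero (inv_ne_zero hd'), padicValRat.inv, padicValRat.of_int, neg_neg,
    ← zpow_natCast]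
  refine zpow_le_zpow_right₀ (by exact_mod_cast hp.out.one_lt.le) ?_
  have : padicValInt p d ≤ Nat.log p M := (padicValNat_le_nat_log _).trans (Nat.log_mono_right hM)
  exact_mod_cast this

/-- `‖c/d‖_p ≤ p^{⌊log_p M⌋}` for `‖c‖_p ≤ 1` and a nonzero integer `|d| ≤ M`. -/
theorem padicNorm_div_int_le_log {c : ℚ} (hc : padicNorm p c ≤ 1) {d : ℤ} (hd : d ≠ 0) {M : ℕ}
    (hM : d.natAbs ≤ M) : padicNorm p (c / (d : ℚ)) ≤ (p : ℚ) ^ (Nat.log p M) := by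
  rw [div_eq_mul_one_div, padicNorm.mul]
  calc padicNorm p c * padicNorm p (1 / (d : ℚ)) ≤ 1 * (p : ℚ) ^ (Nat.log p M) :=
        mul_le_mul hc (padicNorm_inv_int_le_log hd hM) (padicNorm.nonneg _) zero_le_one
    _ = _ := one_mul _

/-- Kummer, crude form: `v_p(C(M,i)) ≤ ⌊log_p M⌋`. -/
theorem padicValNat_choose_le_log (M i : ℕ) : padicValNat p (Nat.choose M i) ≤ Nat.log p M := by
  rw [← Nat.factorization_def _ hp.out]; exact Nat.factorization_choose_le_log

/-- Legendre splitting: `v_p((a+b)!) = v_p(C(a+b,a)) + v_p(a!) + v_p(b!)`. -/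
theorem padicValNat_factorial_add (a b : ℕ) :
    padicValNat p (a + b).factorial
      = padicValNat p (Nat.choose (a + b) a) + padicValNat p a.factorial + padicValNat p b.factorial := by
  have h := Nat.choose_mul_factorial_mul_factorial (Nat.le_add_right a b)
  rw [Nat.add_sub_cancel_left] at h
  rw [← h, padicValNat.mul (mul_ne_zero (Nat.choose_pos (Nat.le_add_right a b)).ne' (Nat.factorial_ne_zero a))
    (Nat.factorial_ne_zero b), padicValNat.mul (Nat.choose_pos (Nat.le_add_right a b)).ne' (Nat.factorial_ne_zero a)]

/-- `v_p((m+1)!) = v_p(m+1) + v_p(m!)`. -/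
theorem padicValNat_factorial_succ (m : ℕ) :
    padicValNat p (m + 1).factorial = padicValNat p (m + 1) + padicValNat p m.factorial := by
  rw [Nat.factorial_succ, padicValNat.mul (Nat.succ_ne_zero m) (Nat.factorial_ne_zero m)]

/-- `v_p` of `(−1)^e · a! · b!` (as a rational). -/
theorem padicValRat_sign_fac_fac (e a b : ℕ) :
    padicValRat p ((-1 : ℚ) ^ e * ((a.factorial : ℕ) : ℚ) * ((b.factorial : ℕ) : ℚ))
      = (padicValNat p a.factorial : ℤ) + (padicValNat p b.factorial : ℤ) := by
  have hs : ((-1 : ℚ) ^ e) ≠ 0 := pow_ne_zero _ (by norm_num)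
  have ha : ((a.factorial : ℕ) : ℚ) ≠ 0 := by positivity
  have hb : ((b.factorial : ℕ) : ℚ) ≠ 0 := by positivity
  rw [padicValRat.mul (mul_ne_zero hs ha) hb, padicValRat.mul hs ha, padicValRat.pow, padicValRat.of_nat,
    padicValRat.of_nat]
  have : padicValRat p (-1) = 0 := by rw [padicValRat.neg, padicValRat.one]
  rw [this]; ring

/-- `v_p` of `(−1)^e · m! · C(K,m)` (as a rational), `m ≤ K`. -/
theorem padicValRat_sign_fac_choose (e m K : ℕ) (hmK : m ≤ K) :
    padicValRat p ((-1 : ℚ) ^ e * ((m.factorial : ℕ) : ℚ) * ((Nat.choose K m : ℕ) : ℚ))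
      = (padicValNat p m.factorial : ℤ) + (padicValNat p (Nat.choose K m) : ℤ) := by
  have hs : ((-1 : ℚ) ^ e) ≠ 0 := pow_ne_zero _ (by norm_num)
  have ha : ((m.factorial : ℕ) : ℚ) ≠ 0 := by positivity
  have hb : ((Nat.choose K m : ℕ) : ℚ) ≠ 0 := by exact_mod_cast (Nat.choose_pos hmK).ne'
  rw [padicValRat.mul (mul_ne_zero hs ha) hb, padicValRat.mul hs ha, padicValRat.pow, padicValRat.of_nat,
    padicValRat.of_nat]
  have : padicValRat p (-1) = 0 := by rw [padicValRat.neg, padicValRat.one]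
  rw [this]; ring

/-- The products `(−1)^e · a! · b!` and `(−1)^e · m! · C(K,m)` (`m ≤ K`) are nonzero. -/
theorem sign_fac_fac_ne_zero (e a b : ℕ) :
    (-1 : ℚ) ^ e * ((a.factorial : ℕ) : ℚ) * ((b.factorial : ℕ) : ℚ) ≠ 0 :=
  mul_ne_zero (mul_ne_zero (pow_ne_zero _ (by norm_num)) (by positivity)) (by positivity)

/-- See `sign_fac_fac_ne_zero`. -/
theorem sign_fac_choose_ne_zero (e m K : ℕ) (hmK : m ≤ K) :
    (-1 : ℚ) ^ e * ((m.factorial : ℕ) : ℚ) * ((Nat.choose K m : ℕ) : ℚ) ≠ 0 :=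
  mul_ne_zero (mul_ne_zero (pow_ne_zero _ (by norm_num)) (by positivity))
    (by exact_mod_cast (Nat.choose_pos hmK).ne')

/-- From a valuation lower bound to a norm bound: `v_p(q) ≥ −N ⇒ ‖q‖_p ≤ p^N`. -/
theorem padicNorm_le_pow_of_val {q : ℚ} {N : ℕ} (h : -(N : ℤ) ≤ padicValRat p q) :
    padicNorm p q ≤ (p : ℚ) ^ N := by
  by_cases hq : q = 0
  · rw [hq, padicNorm.zero]; positivity
  rw [padicNorm.eq_zpow_of_nonzero hq, ← zpow_natCast]
  exact zpow_le_zpow_right₀ (by exact_mod_cast hp.out.one_lt.le) (by omega)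

/-! ### Crude bounds for the alternating harmonic sums -/

/-- `‖Σ_{ℓ≤m} (−1)^{ℓ−1}/ℓ²‖_p ≤ p^{2⌊log_p M⌋}` for `m ≤ M`. -/
theorem padicNorm_harmAlt2_le_log {m M : ℕ} (hm : m ≤ M) :
    padicNorm p (harmAlt2 m) ≤ (p : ℚ) ^ (2 * Nat.log p M) := by
  unfold harmAlt2
  refine padicNorm.sum_le' (fun l hl => ?_) (by positivity)
  have hl' := mem_range.1 hl
  have hs : padicNorm p ((-1 : ℚ) ^ l) ≤ 1 := by
    have := padicNorm.of_int (p := p) ((-1) ^ l); push_cast at this; exact this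
  have hne : ((l : ℤ) + 1) ≠ 0 := by omega
  have h1 : padicNorm p (1 / (((l + 1 : ℤ) : ℤ) : ℚ)) ≤ (p : ℚ) ^ (Nat.log p M) :=
    padicNorm_inv_int_le_log (p := p) hne (by omega)
  have h1' : padicNorm p (1 / ((l : ℚ) + 1)) ≤ (p : ℚ) ^ (Nat.log p M) := by push_cast at h1; simpa using h1
  have e : (-1 : ℚ) ^ l / ((l : ℚ) + 1) ^ 2 = (-1) ^ l * (1 / ((l : ℚ) + 1)) * (1 / ((l : ℚ) + 1)) := by
    field_simp
  rw [e, padicNorm.mul, padicNorm.mul, two_mul, pow_add]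
  exact mul_le_mul (mul_le_of_le_one_left (padicNorm.nonneg _) hs |>.trans h1') h1' (padicNorm.nonneg _)
    (by positivity)

/-- `‖Σ_{ℓ≤m} (−1)^{ℓ−1}/ℓ‖_p ≤ p^{⌊log_p M⌋}` for `m ≤ M`. -/
theorem padicNorm_harmAlt1_le_log {m M : ℕ} (hm : m ≤ M) :
    padicNorm p (harmAlt1 m) ≤ (p : ℚ) ^ (Nat.log p M) := by
  unfold harmAlt1
  refine padicNorm.sum_le' (fun l hl => ?_) (by positivity)
  have hl' := mem_range.1 hl
  have hs : padicNorm p ((-1 : ℚ) ^ l) ≤ 1 := by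
    have := padicNorm.of_int (p := p) ((-1) ^ l); push_cast at this; exact this
  have hne : ((l : ℤ) + 1) ≠ 0 := by omega
  have h1 : padicNorm p (1 / (((l + 1 : ℤ) : ℤ) : ℚ)) ≤ (p : ℚ) ^ (Nat.log p M) :=
    padicNorm_inv_int_le_log (p := p) hne (by omega)
  have h1' : padicNorm p (1 / ((l : ℚ) + 1)) ≤ (p : ℚ) ^ (Nat.log p M) := by push_cast at h1; simpa using h1
  have e : (-1 : ℚ) ^ l / ((l : ℚ) + 1) = (-1) ^ l * (1 / ((l : ℚ) + 1)) := by ring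
  rw [e, padicNorm.mul]
  exact mul_le_of_le_one_left (padicNorm.nonneg _) hs |>.trans h1'

end Tools

end Summit.KontsevichZagierPeriods.Zeta5Search.TwoTaleP15

end
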